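import Mathlib
import HarnessLib

/-!
# Linearly disjoint compositum: a basis of `L/E` stays a basis of `L'/E'` when `L' = E'·L` and `[L' : E'] = [L : E]`

Field-theoretic input of the base change of the semi-local norm (`Literature/NumberTheory/NumberFields/SemilocalNormBaseChange.lean`,
hypothesis `hb`) and of the inclusion maps of pinned data `U_∞/𝒞_∞` along a sub-tower (cell `bsd-print-cf2`, width seat `bsd-line-cf2c-w6` g7,
`--supports` 24721). THEOREMS ONLY, no `sorry`; pure Mathlib field theory. HONEST FRAMING: nothing about BSD.

For intermediate fields `E ≤ E'`, `E ≤ L`, `E' ≤ L'`, `L ≤ L'` of an extension `M/K` with `L/K` finite, `L' ≤ E' ⊔ L` and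
`finrank_{E'} L' = finrank_E L`: **`IntermediateField.exists_basis_eq_of_le_sup`** — there are bases `b₀` of `L/E` and `b₀'` of `L'/E'`, indexed
alike, with the same underlying elements of `M` (`E' ⊔ L` is the `E'`-span of `L` because `L` is algebraic — Mathlib
`IntermediateField.sup_toSubalgebra_of_isAlgebraic_right`, `Algebra.adjoin_eq_span` — so the image of a basis of `L/E` spans `L'/E'`, and a spanning
family of the right size is a basis, `basisOfTopLeSpanOfCardEqFinrank`). Also the spanning statement alone (`coe_mem_span_of_le_sup`).

References: S. Lang, *Algebra* (GTM 211, 2002), Ch. VIII §3 (linearly disjoint extensions; a basis of `L/E` stays a basis of `E'L/E'`)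
[Lang2002].
-/

noncomputable section

universe u v

namespace Literature.NumberTheory.NumberFields

open Module Submodule

variable {K : Type u} [Field K] {M : Type v} [Field M] [Algebra K M] {E E' L L' : IntermediateField K M}

/-- **`E' ⊔ L` is the `E'`-span of `L`** (`L/K` algebraic): every element of an intermediate field `L' ≤ E' ⊔ L` lies in the `E'`-submodule of
`M` spanned by `L`. [cite: Lang2002, Ch. VIII §3] -/
theorem IntermediateField.coe_mem_span_of_le_sup [Algebra.IsAlgebraic K L] (hsup : L' ≤ E' ⊔ L) (x : L') :
    (x : M) ∈ span E' (L : Set M) := by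
  have hx : (x : M) ∈ (E' ⊔ L).toSubalgebra := hsup x.2
  rw [IntermediateField.sup_toSubalgebra_of_isAlgebraic_right, Algebra.sup_def, ← Subalgebra.mem_toSubmodule,
    Algebra.adjoin_eq_span] at hx
  -- the `K`-span of the monoid generated by `E' ∪ L` lies in the `E'`-span of `L`
  have hcl : (Submonoid.closure ((E'.toSubalgebra : Set M) ∪ (L.toSubalgebra : Set M)) : Set M) ⊆
      ((span E' (L : Set M)).restrictScalars K : Submodule K M) := by
    intro y hy
    refine Submonoid.closure_induction (fun z hz ↦ ?_) ?_ (fun a b _ _ ha hb ↦ ?_) hy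
    · rcases hz with hz | hz
      · have h1 : z = (⟨z, hz⟩ : E') • ((1 : L) : M) := by rw [OneMemClass.coe_one, Algebra.smul_def, mul_one]; rfl
        rw [SetLike.mem_coe, restrictScalars_mem, h1]
        exact smul_mem _ _ (subset_span (SetLike.coe_mem (1 : L)))
      · exact subset_span hz
    · exact subset_span (SetLike.coe_mem (1 : L))
    · rw [SetLike.mem_coe, restrictScalars_mem] at ha hb ⊢
      have hab : a * b ∈ span E' (L : Set M) * span E' (L : Set M) := mul_mem_mul ha hb
      rw [span_mul_span] at hab
      refine span_le.2 (fun c hc ↦ ?_) hab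
      obtain ⟨s, hs, t, ht, rfl⟩ := Set.mem_mul.1 hc
      exact subset_span (L.mul_mem hs ht)
  exact (span_le.2 hcl) hx

/-- **Linearly disjoint compositum: matched bases.** For `E ≤ E'`, `E ≤ L`, `E' ≤ L'`, `L ≤ L'` with `L/K` finite, `L' ≤ E' ⊔ L` and
`[L' : E'] = [L : E]`, there are a basis `b₀` of `L` over `E` and a basis `b₀'` of `L'` over `E'`, indexed alike, with `(b₀' i : M) = (b₀ i : M)`.
[cite: Lang2002, Ch. VIII §3 (criterion: linearly disjoint iff a basis stays linearly independent)] -/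
theorem IntermediateField.exists_basis_eq_of_le_sup (hEE' : E ≤ E') (hEL : E ≤ L) (hE'L' : E' ≤ L') (hLL' : L ≤ L')
    [FiniteDimensional K L] (hsup : L' ≤ E' ⊔ L)
    (hdeg : letI := (IntermediateField.inclusion hEL).toRingHom.toAlgebra;
      letI := (IntermediateField.inclusion hE'L').toRingHom.toAlgebra; finrank E' L' = finrank E L) :
    ∃ (κ : Type) (_ : Fintype κ)
      (b₀ : letI := (IntermediateField.inclusion hEL).toRingHom.toAlgebra; Module.Basis κ E L)
      (b₀' : letI := (IntermediateField.inclusion hE'L').toRingHom.toAlgebra; Module.Basis κ E' L'),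
      ∀ i, ((b₀' i : L') : M) = ((b₀ i : L) : M) := by
  letI algEL : Algebra E L := (IntermediateField.inclusion hEL).toRingHom.toAlgebra
  letI algE'L' : Algebra E' L' := (IntermediateField.inclusion hE'L').toRingHom.toAlgebra
  haveI : IsScalarTower K E L := IsScalarTower.of_algebraMap_eq fun _ ↦ rfl
  haveI : Module.Finite E L := Module.Finite.of_restrictScalars_finite K E L
  haveI : Module.Free E L := Module.Free.of_divisionRing E L
  let b₀ := Module.finBasis E L
  let f : Fin (finrank E L) → L' := fun i ↦ IntermediateField.inclusion hLL' (b₀ i)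
  -- the `E'`-linear embedding `L' → M`
  let val' : L' →ₗ[E'] M := { toFun := fun x ↦ (x : M), map_add' := fun _ _ ↦ rfl, map_smul' := fun _ _ ↦ rfl }
  -- (A) `L` lies in the `E'`-span of the `b₀ i`
  have hA : (L : Set M) ⊆ span E' (Set.range fun i ↦ ((b₀ i : L) : M)) := by
    intro y hy
    set z : L := ⟨y, hy⟩
    have hz : L.val (∑ i, b₀.repr z i • b₀ i) = y := by rw [b₀.sum_repr z]; rfl
    rw [← hz, map_sum]
    refine sum_mem fun i _ ↦ ?_
    have h1 : L.val (b₀.repr z i • b₀ i) = (⟨_, hEE' (b₀.repr z i).2⟩ : E') • ((b₀ i : L) : M) := by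
      rw [Algebra.smul_def]; rfl
    rw [h1]
    exact smul_mem _ _ (subset_span ⟨i, rfl⟩)
  -- (B)+(C) the family `f` spans `L'` over `E'`
  have hspan : ⊤ ≤ span E' (Set.range f) := by
    intro x _
    have hx : (x : M) ∈ span E' (Set.range fun i ↦ ((b₀ i : L) : M)) :=
      span_le.2 hA (IntermediateField.coe_mem_span_of_le_sup hsup x)
    have himg : span E' (Set.range fun i ↦ ((b₀ i : L) : M)) = (span E' (Set.range f)).map val' := by
      rw [map_span, ← Set.range_comp]
      rfl
    rw [himg] at hx
    obtain ⟨y, hy, hyx⟩ := hx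
    rwa [← Subtype.val_injective hyx]
  have hcard : Fintype.card (Fin (finrank E L)) = finrank E' L' := by rw [Fintype.card_fin, hdeg]
  refine ⟨Fin (finrank E L), inferInstance, b₀, basisOfTopLeSpanOfCardEqFinrank f hspan hcard, fun i ↦ ?_⟩
  rw [coe_basisOfTopLeSpanOfCardEqFinrank]
  rfl

end Literature.NumberTheory.NumberFields

end
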